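import Summits.HodgeConjecture.HodgeConjecture.Theses.HeckePrymWeil

/-!
# `WeilTwelvefoldsSqrtMinus7` (stmt-HodgeConjecture-1261) · Negative · where a kill would propagate

Negative-side knowledge for the crux `HeckePrymWeil.WeilTwelvefoldsSqrtMinus7`, from the standing
disprover's work file `Cruxes/WeilTwelvefoldsSqrtMinus7/Disproof.lean` §7
(refuter-cdisprove-stmt-HodgeConjecture-1261-g2-0, cycle 2, 2026-08-16), negative forms only:

* `not_ladder_of_not_weilTwelvefolds` : `¬ WeilTwelvefoldsSqrtMinus7 → ¬ HodgeWeilLadder` — the crux is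
  literally rung `(p, g') = (7, 3)` of the target (the target's `((7:ℕ):ℤ)`, `Real.sqrt ((7:ℕ):ℝ)`,
  `2 * 6` spellings are definitionally the crux's), so a refutation of the crux refutes the target;
* `not_weilTwelvefolds_of_not_weilSixfolds` : `WeilDescending → ¬ WeilSixfoldsSqrtMinus7 →
  ¬ WeilTwelvefoldsSqrtMinus7` — with the route's component-free descending lemma the dimension-12 rung
  implies the dimension-6 rung (three descents `6 → 5 → 4 → 3`, abstract `descend_logic`), so every
  refutation of the sixfold crux 1260 transfers to this crux (the planner's "rung (7,3) covers
  WeilSixfoldsSqrtMinus7", contraposed, as a theorem).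
-/

noncomputable section

set_option linter.dupNamespace false

namespace Summit.HodgeConjecture.HodgeConjecture.Theorems.WeilTwelvefoldsSqrtMinus7.Negative

open Summit.HodgeConjecture.HodgeConjecture.Theses.HeckePrymWeil

/-- Pure logic of the ladder: a one-step descending rule lowers a rung predicate `P` from `a` to every
`b` with `1 ≤ b ≤ a`. [folklore] -/
theorem descend_logic (P : ℕ → Prop)
    (hDesc : ∀ n : ℕ, 1 ≤ n → (∀ m : ℕ, m = n + 1 → P m) → P n)
    {a b : ℕ} (hb : 1 ≤ b) (hab : b ≤ a) (ha : P a) : P b := by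
  obtain ⟨d, rfl⟩ : ∃ d, a = b + d := ⟨a - b, by omega⟩
  induction d generalizing b with
  | zero => simpa using ha
  | succ d ih =>
    exact hDesc b hb fun m hm => ih (by omega) (by omega) (by rw [hm]; convert ha using 1; omega)

/-- **A kill of the crux kills the target**: `WeilTwelvefoldsSqrtMinus7` is rung `(7, 3)` of
`HodgeWeilLadder` by instantiation. [folklore] -/
theorem not_ladder_of_not_weilTwelvefolds (h : ¬ WeilTwelvefoldsSqrtMinus7) : ¬ HodgeWeilLadder :=
  fun hL => h (hL 7 (by norm_num) (by norm_num) le_rfl 3 (by norm_num) 6 (by norm_num))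

/-- **A kill of the sixfold rung kills the crux, given `WeilDescending`** (descend `6 → 3` at `p = 7`).
[folklore] -/
theorem not_weilTwelvefolds_of_not_weilSixfolds (hD : WeilDescending) (h : ¬ WeilSixfoldsSqrtMinus7) :
    ¬ WeilTwelvefoldsSqrtMinus7 :=
  fun h12 => h (descend_logic _ (hD 7 (by norm_num) (by norm_num) le_rfl) (by norm_num)
    (by norm_num : 3 ≤ 6) h12)

end Summit.HodgeConjecture.HodgeConjecture.Theorems.WeilTwelvefoldsSqrtMinus7.Negative

end
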